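/-
Copyright: statement-level skeleton of a published paper (lit-balaban cell, Phase-2 proof seat p13, gen 11). No proof
claims beyond what the kernel checks below.
-/
import Mathlib.Analysis.Calculus.Deriv.Polynomial
import Mathlib.Analysis.Calculus.ContDiff.Polynomial
import Mathlib.Algebra.Polynomial.Derivative
import Literature.MathematicalPhysics.QuantumFieldTheory.BalabanImbrieJaffe1984to88.BIJ88Eq5713Localized
import Literature.MathematicalPhysics.QuantumFieldTheory.BalabanImbrieJaffe1984to88.BIJ88PertQ5715
import Literature.MathematicalPhysics.QuantumFieldTheory.BalabanImbrieJaffe1984to88.BIJ88LeadGroupCompose294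

/-!
# `BalabanImbrieJaffe1984to88.BIJ88LowOrderWords291` — T. Bałaban, J. Imbrie, A. Jaffe, *Effective action and cluster
properties of the abelian Higgs model*, Commun. Math. Phys. **114** (1988) 257–315 [BalabanImbrieJaffe1988]: Sect. 5.7,
p. 291 — THE SEPARATED LOW-ORDER TERMS ARE THE TAYLOR COEFFICIENTS OF `log Z` IN `e′` (the unnumbered display of p. 291),
on the word model of the trace terms of (5.7.4) — for the truncated series, for the full series (5.7.4) as a power series in
`e′`, and for `log` of the typed normalization factor (4.9) along the family — and their hand-over to the resummation (5.7.10)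
and to the perturbative functional of (5.6.14)/(5.7.15)

statement-level skeleton of published theorems with citation tags; proofs where landed; nothing here is a claim about the Yang–Mills mass gap

PDF held: `paper:balaban1988-cmp114-bij-abelian-higgs-effective-action` (journal page = PDF page + 256); pp. 291–292
[PDF 35–36] read as IMAGES this session (CCITT renders `HOME/lit-balaban-p13/pages/original-p035-x2.png`, `…-p036-x2.png`).

CITATION HEADER (lean-in-tree rule).  Part of the lit-balaban TYPED SKELETON (HOME `run/shared/lean/pub/lit-balaban/`):
rows **C2.Eq5.7.13-5.7.15** (claim; flip criterion of the owner: *"NOT composed: the resummation (5.7.10)–(5.7.12) feeding the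
low-order words into Q^{(k)} = (5.7.15) …"*) and **C2.Eq5.7.10-5.7.12** (member p. 291 display) of
`HOME/lit-balaban-r16/ROWS-C2-part2.md`; unit `lit-balaban-p13` (gen 11), owner r16, referee ref-5.  Built BY NAME on the gen-8
word model `BIJ88TraceTerms579` (`letter`, `wlen`, `trace_pow_eq_sum_words`, `sum_words_eq_sum_hulls`), on the low-order part
`LOW_j` of `BIJ88Eq5713Localized.prod_Z49_eq5713_order`, on `BIJ88Resummation5710.lowOrder`/`lowOrder_eq_sum_iteratedDeriv`
((5.7.10)), on the sister file `BIJ88LeadGroupCompose294` (`pertP_eq_neg_taylor`, `leadGroup_max_eq_neg_pertP`), on r16's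
`BIJ88Sect5StatementsPart4.pertP` ((5.6.14)) and on p02's `BIJ88PertQ5715.pertQ5715`/`logZ` ((5.7.15)) and
`BIJ88TraceLog574.Z49_eq574` ((5.7.3)–(5.7.4)) with `BIJ88Normalization46.Z49` ((4.9)); nothing restated.

## The print (p. 291 [PDF 35] and p. 292 [PDF 36], verbatim)

p. 291: *"In the expansion (5.7.4) we put W^{(j)} = W^{(j,n̄)} + Σ_X W^{(j)}(X). In terms with l ≤ n̄ we separate from
(1/2l) tr(C^{(j)}_{Λ₁₀^{(j)}}(u_{k+1})W^{(j,n̄)}) the terms of order ≤ n̄ in e_j. We can write the sum of all these terms as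
  Σ_{n=1}^{n̄} (1/n!) [ dⁿ/de′ⁿ log Z^{(j)}_{Λ₁₀^{(j)}}(u_{k+1} exp(ie′e_jζÃ̃^ζ)) ]_{e′=0} .
These will be treated carefully by a resummation."*  p. 290: *"Terms whose order in e_j (or equivalently in Ã̃) is between
1 and n̄ …"*.  p. 292: *"The expansions for F_{1,j}, F_{2,j} are inserted in the low order terms in V_j, G_{j,loc}(u_{k+1}ũ̃), and
Δ_{k,loc}(u_{k+1}ũ̃) + aL^{−2}P(u_{k+1}ũ̃). Finally, they are inserted into (5.7.10), using (5.7.4) for log Z."*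

## The typing (model instance, READING declared — the gen-8 word model of (5.7.4), `BIJ88TraceTerms579`)

* The letters `C = Σ_a C_a`, `W = Σ_b W_b` (real kernels on the sites `T`, cube supports `sC`, `sW`), words
  `w : Fin l → A × B`, their terms `tr(C_{a₁}W_{b₁}⋯C_{a_l}W_{b_l})` and `wlen l S X` are those of `BIJ88TraceTerms579`.
* *"order in e_j (or equivalently in Ã̃)"*: every `W`-letter `W_b` is HOMOGENEOUS of degree `deg b ≥ 1` in the field, so along
  the one-parameter family `e′ ↦ u_{k+1} exp(ie′e_jζÃ̃)` of the display it is `W_b(e′) = e′^{deg b}·W_b` (`scaleW`), the value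
  at `e′ = 1` being the letter itself (`scaleW_one`); the total order of a word is `wdeg w = Σ_i deg b_i` — the grading of
  `BIJ88Eq5713Localized.prod_Z49_eq5713_order`, whose separated part is
  `LOW = Σ_{l<n̄} Σ_X (1/(2(l+1)))·wlen (l+1) (¬(n̄+1 ≤ wdeg)) X`.
* *"using (5.7.4) for log Z"*: along the family, `log Z^{(j)}(u_{k+1}exp(ie′…)) − log Z^{(j)}(u_{k+1}) = Σ_{l≥1} (1/2l) tr((C W(e′))^l)`
  (p02's `BIJ88TraceLog574.Z49_eq574`, `Z^{(j)}` = the typed normalization factor (4.9) `BIJ88Normalization46.Z49` at the inverse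
  covariance `C⁻¹ − W^{(j)}` of (5.7.2)); the GENERATING FUNCTION `genFun N e′ = Σ_{l ≤ N} (1/2l) tr((C W(e′))^l)` is this series
  through the words of length `≤ N` (exact for the coefficients of order `≤ N`, `coeff_genPolyX_eq_of_le`), and `genSeries e′` is
  the full series (§6: its Taylor coefficients at `0` are the same, under the letter-norm smallness `θ = N_C·N_W < 1`,
  `N_C = Σ_a ‖C_a‖`, `N_W = Σ_b ‖W_b‖`, `ℓ^∞`-operator norms as in `BIJ88TraceLog574`).

## What is kernel-checked (zero `sorry`, theorems + nine definitions with bodies, no `Prop` facts, axioms standard)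

* §1 `bprod_scaleW`, `trace_pow_scaleW` — `tr((C W(e′))^l) = Σ_w e′^{wdeg w}·tr(C_{a₁}W_{b₁}⋯)`: the order in `e′` of a word is
  its total field order.
* §2 `genFun_eq_eval` (the generating function is the polynomial `genPolyX`), `coeff_genPolyX` (its `n`-th coefficient = the
  words of total order `n`, weights `1/2l`), **`iteratedDeriv_genFun_zero`** (`dⁿ/de′ⁿ genFun |₀ = n!·coeff n`),
  `coeff_genPolyX_eq_of_le` (independence of the truncation `N ≥ n`).
* §3 **`lowWords_eq_taylor`** — THE p. 291 DISPLAY on the model: for `deg ≥ 1` and `N ≥ n̄`,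
  `LOW = Σ_{n=1}^{n̄} (1/n!)·[dⁿ/de′ⁿ genFun N]_{e′=0}` — *"the sum of all these terms"* (the words of order `≤ n̄` in the terms
  `l ≤ n̄`) IS the order-`n̄` Taylor sum at `e′ = 0`; `genFun_zero` (`genFun N 0 = 0`: at `e′ = 0` the family sits at `u_{k+1}`).
* §4 hand-over to (5.7.10): **`lowOrder_eq_lowWords`** — for a function `Φ` of the scale parameters `(e′_l)_{l∈S}` whose
  diagonal `t ↦ Φ(t·𝟙_S)` is `log Z^{(j)}(u_{k+1}) + genFun N t` (all scales switched on together = the one field `Ã̃ = Σ_l Ã̃_l`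
  of p. 291), `BIJ88Resummation5710.lowOrder Φ n̄ S = LOW` (so `eq5710` regroups exactly the separated words).
* §5 hand-over to the perturbative functional (`BIJ88LeadGroupCompose294.pertP_eq_neg_taylor`: r16's (5.6.14)/(5.14.2)
  functional is `pertP F n̄ = −Σ_{n=1}^{n̄}(1/n!)F^{(n)}(0)` for `F ∈ C^{n̄}`): `contDiff_genFun` and
  **`pertP_genFun_eq_neg_lowWords`** (`pertP (genFun N) n̄ = −LOW`: the separated words of one scale, with the sign and weights of
  the print's `−Q`/`−𝒫`, cf. p02's `pertQ5715 = pertP (logZ …)`).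
* §6 THE FULL SERIES: `genSeries` (Σ_{l≥1}(1/2l)tr((CW(e′))^l) along the family), `lowCoeff n` (the words of order `n`),
  `sum_abs_trace_words_le` (`Σ_w |tr(word)| ≤ |T|·θ^{l}`), **`hasSum_lowCoeff_pow`** (for `|e′| ≤ 1`, `θ < 1`: `Σ_n lowCoeff n·e′ⁿ`
  sums to `genSeries e′` — the absolutely convergent double series over (length, order) regrouped), `abs_lowCoeff_le`,
  **`hasFPowerSeriesOnBall_genSeries`** (power series at `0` on the unit ball), **`iteratedDeriv_genSeries_zero`**
  (`dⁿ/de′ⁿ genSeries|₀ = n!·lowCoeff n`), `iteratedDeriv_genSeries_eq_genFun`, **`lowWords_eq_taylor_series`**; and WITH `log Z`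
  ITSELF: `log_Z49_family_eq` (p02's `Z49_eq574` in logarithmic form at the parameter `e′`) and **`lowWords_eq_taylor_logZ49`** —
  `LOW = Σ_{n<n̄} (1/(n+1)!)·[d^{n+1}/de′^{n+1} log Z49(C⁻¹ − W(e′))]_{e′=0}` when the smallness of (5.7.3)–(5.7.4) holds for `|e′| < 1`:
  the display of p. 291 with the typed (4.9) normalization factor; `pertP_eq_neg_taylor_of_contDiffAt`, `contDiffAt_genSeries`,
  **`pertP_genSeries_eq_neg_lowWords`** and **`pertP_logZ49_eq_neg_lowWords`** (`−𝒫(log Z^{(j)} along the family) = LOW` for r16's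
  (5.6.14)/(5.7.15) functional `pertP`, smoothness needed at `e′ = 0` only).
* §7 THE MULTI-SCALE WORD MODEL OF (5.7.10): `scaleWMulti` (a letter of order `deg b` along `e′ = (e′_l)`:
  `Σ_{J : Fin (deg b) → L} (Π_α e′_{Jα})·W_{b,J}`, the multilinear expansion in `Ã̃ = Σ_l Ã̃_l` of p. 292), `lettersOn S` (the letters seen
  on the scales `S`), `genFunMulti` (the multi-scale generating function), `scaleWMulti_diag`/**`genFunMulti_diag`** (its diagonal
  `t·𝟙_S` IS the one-parameter generating function of the letters seen on `S`), `contDiff_genFunMulti`, and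
  **`lowOrder_genFunMulti`** / **`lowWords_eq_sum_leadGroup`** — `lowOrder (genFunMulti N) n̄ S = LOW` with NO diagonal hypothesis,
  hence `LOW = Σ_{m∈S} leadGroup (genFunMulti N) n̄ S m` ((5.7.10) `eq5710` for the words themselves); **`leadGroup_max_genFunMulti`**
  — the TOP group `m = k` is the separated words of the letters seen on the scale `k` alone (what p. 295 sends to `Q^{(k)}`).
* §8 THE COMMON FUNCTION WITH p02's (5.7.15) (owner's refined flip condition (ii), seat INBOX 02:51Z): `logZ_eq_log_Z49` (p02's
  bracket `BIJ88PertQ5715.logZ M e′` IS `log Z49(M(e′)) 0 0`), **`pertQ5715_family_eq_neg_lowWords`** (`pertQ5715` evaluated on the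
  family `e′ ↦ C⁻¹ − W^{(j)}(e′)` of (5.7.2) `= −LOW`) and **`leadGroup_max_eq_neg_pertQ5715`** (the `k`-th group of (5.7.10) for the
  multi-scale generating function `= −pertQ5715` of the family built from the letters seen on `k`): the low-order words / the
  `k`-th group and `Q^{(k)}` computed on ONE AND THE SAME function.
READINGS (declared): (r1) the letters (in §7: their scale pieces `W_{b,J}`), the grading `deg ≥ 1` and the supports are INPUTS
(nothing of Sects. 2–5 is constructed), and so are the smallness hypotheses along the family (`θ < 1`; positivity of `C⁻¹ − W(e′)`
and `‖C^{1/2}W(e′)C^{1/2}‖ < 1` for `|e′| < 1` in §6 — the print's *"the operator after the identity is bounded by a very small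
number"*, p. 289); (r2) in §4 the multi-parameter `Φ` of (5.7.10) is an input linked to the words through its diagonal, in §7 it
is the (truncated) multi-scale generating function itself.  HONEST SCOPE: finite algebra,
one-variable calculus and the regrouping of an absolutely convergent double series; nothing of the bounds (5.7.9)/(5.7.14), of
the replacements (5.7.11)–(5.7.12) or of B1–B16 is touched.  NOT summit progress; NOT continuum; NOT Clay.  Imports Literature and
Mathlib only; modifies nothing.
-/

namespace Literature.MathematicalPhysics.QuantumFieldTheory.BalabanImbrieJaffe1984to88.BIJ88LowOrderWords291

open Finset
open Literature.MathematicalPhysics.QuantumFieldTheory.Balaban1983to89.B4RandomWalk213 (bprod bprod_zero bprod_succ)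
open BIJ88TraceTerms579 (letter hull wlen sum_words_eq_sum_hulls trace_pow_eq_sum_words)
open BIJ88Resummation5710 (lowOrder lowOrder_eq_sum_iteratedDeriv)
open scoped Matrix Matrix.Norms.Operator Polynomial

variable {T ι A B : Type*} [Fintype T] [DecidableEq T] [Fintype ι] [DecidableEq ι]
  [Fintype A] [DecidableEq A] [Fintype B] [DecidableEq B]

/-! ## §1 Homogeneous letters: the order in `e′` of a word is its total field order -/

section Scaled

/-- The TOTAL ORDER of a word `w = ((a₁,b₁),…,(a_l,b_l))` in `e_j` *"(or equivalently in Ã̃)"*: `Σ_i deg b_i`.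
[cite: BalabanImbrieJaffe1988, p.290–291] -/
def wdeg (deg : B → ℕ) (l : ℕ) (w : Fin l → A × B) : ℕ := ∑ i, deg (w i).2

/-- The `W`-letters ALONG THE ONE-PARAMETER FAMILY `e′ ↦ u_{k+1} exp(ie′e_jζÃ̃)` of the p. 291 display: a letter homogeneous of
degree `deg b` in the field is `W_b(e′) = e′^{deg b}·W_b`. [cite: BalabanImbrieJaffe1988, p.291] -/
def scaleW (Wl : B → Matrix T T ℝ) (deg : B → ℕ) (t : ℝ) (b : B) : Matrix T T ℝ := t ^ deg b • Wl b

variable (Cl : A → Matrix T T ℝ) (Wl : B → Matrix T T ℝ) (deg : B → ℕ) (t : ℝ)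

omit [Fintype T] [DecidableEq T] [Fintype A] [DecidableEq A] [Fintype B] [DecidableEq B] in
/-- at `e′ = 1` the family is the letter itself. [cite: BalabanImbrieJaffe1988, p.291] -/
theorem scaleW_one : scaleW Wl deg 1 = Wl := by
  funext b
  simp [scaleW]

omit [Fintype A] [DecidableEq A] [Fintype B] [DecidableEq B] in
/-- the total order of the empty word is `0`. [cite: BalabanImbrieJaffe1988, p.291] -/
theorem wdeg_zero (w : Fin 0 → A × B) : wdeg deg 0 w = 0 := by
  simp [wdeg]

omit [Fintype A] [DecidableEq A] [Fintype B] [DecidableEq B] in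
/-- the total order of `(p, w)` is `deg p.2 + wdeg w`. [cite: BalabanImbrieJaffe1988, p.291] -/
theorem wdeg_succ (l : ℕ) (w : Fin (l + 1) → A × B) : wdeg deg (l + 1) w = deg (w 0).2 + wdeg deg l (Fin.tail w) := by
  simp [wdeg, Fin.sum_univ_succ, Fin.tail]

omit [Fintype A] [DecidableEq A] [Fintype B] [DecidableEq B] in
/-- every word of length `l` has total order `≥ l` when each letter has order `≥ 1`. [cite: BalabanImbrieJaffe1988, p.291] -/
theorem le_wdeg (hdeg : ∀ b, 1 ≤ deg b) (l : ℕ) (w : Fin l → A × B) : l ≤ wdeg deg l w :=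
  calc l = ∑ _i : Fin l, 1 := by simp
    _ ≤ wdeg deg l w := Finset.sum_le_sum fun i _ => hdeg (w i).2

omit [Fintype ι] [DecidableEq ι] [Fintype A] [DecidableEq A] [Fintype B] [DecidableEq B] in
/-- **THE ORDER IN `e′` OF A WORD**: `C_{a₁}W_{b₁}(e′)⋯C_{a_l}W_{b_l}(e′) = e′^{wdeg w}·C_{a₁}W_{b₁}⋯C_{a_l}W_{b_l}`.
[cite: BalabanImbrieJaffe1988, p.291] -/
theorem bprod_scaleW : ∀ (l : ℕ) (w : Fin l → A × B),
    bprod (letter Cl (scaleW Wl deg t)) l w = t ^ wdeg deg l w • bprod (letter Cl Wl) l w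
  | 0, w => by simp [bprod_zero, wdeg_zero]
  | l + 1, w => by
      rw [bprod_succ, bprod_succ, bprod_scaleW l (Fin.tail w), wdeg_succ, pow_add]
      simp only [letter, scaleW, Matrix.mul_smul, Matrix.smul_mul, smul_smul]
      congr 1
      exact mul_comm _ _

omit [Fintype ι] [DecidableEq ι] [Fintype A] [DecidableEq A] [Fintype B] [DecidableEq B] in
/-- … hence its trace term is `e′^{wdeg w}·tr(C_{a₁}W_{b₁}⋯)`. [cite: BalabanImbrieJaffe1988, p.291] -/
theorem trace_bprod_scaleW (l : ℕ) (w : Fin l → A × B) :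
    (bprod (letter Cl (scaleW Wl deg t)) l w).trace = t ^ wdeg deg l w * (bprod (letter Cl Wl) l w).trace := by
  rw [bprod_scaleW, Matrix.trace_smul, smul_eq_mul]

omit [Fintype ι] [DecidableEq ι] [DecidableEq A] [DecidableEq B] in
/-- **`tr((C W(e′))^l) = Σ_w e′^{wdeg w}·tr(C_{a₁}W_{b₁}⋯C_{a_l}W_{b_l})`** — the `l`-th term of (5.7.4) along the family, over
the words (gen 8's `trace_pow_eq_sum_words` for the scaled letters). [cite: BalabanImbrieJaffe1988, (5.7.4) p.289, p.291] -/
theorem trace_pow_scaleW (l : ℕ) :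
    (((∑ a, Cl a) * (∑ b, scaleW Wl deg t b)) ^ l).trace =
      ∑ w : Fin l → A × B, t ^ wdeg deg l w * (bprod (letter Cl Wl) l w).trace := by
  rw [trace_pow_eq_sum_words]
  exact Finset.sum_congr rfl fun w _ => trace_bprod_scaleW Cl Wl deg t l w

end Scaled

/-! ## §2 The generating function *"using (5.7.4) for log Z"* and its Taylor coefficients at `e′ = 0` -/

section Generating

variable (Cl : A → Matrix T T ℝ) (Wl : B → Matrix T T ℝ) (deg : B → ℕ)

/-- **THE GENERATING FUNCTION** `genFun N e′ = Σ_{l=1}^{N} (1/2l)·tr((C W(e′))^l)` — (5.7.4) for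
`log Z^{(j)}(u_{k+1}exp(ie′e_jζÃ̃)) − log Z^{(j)}(u_{k+1})` along the family, through the words of length `≤ N` (index `l`
from `0`, printed `l` being `l + 1`). [cite: BalabanImbrieJaffe1988, (5.7.4) p.289, p.291–292] -/
noncomputable def genFun (N : ℕ) (t : ℝ) : ℝ :=
  ∑ l ∈ Finset.range N, 1 / (2 * ((l : ℝ) + 1)) * (((∑ a, Cl a) * (∑ b, scaleW Wl deg t b)) ^ (l + 1)).trace

/-- The generating function as a POLYNOMIAL in `e′`: `Σ_{l<N} Σ_w (1/(2(l+1)))·tr(C_{a₁}W_{b₁}⋯)·X^{wdeg w}`.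
[cite: BalabanImbrieJaffe1988, p.291] -/
noncomputable def genPolyX (N : ℕ) : ℝ[X] :=
  ∑ l ∈ Finset.range N, ∑ w : Fin (l + 1) → A × B,
    Polynomial.C (1 / (2 * ((l : ℝ) + 1)) * (bprod (letter Cl Wl) (l + 1) w).trace) * Polynomial.X ^ wdeg deg (l + 1) w

omit [Fintype ι] [DecidableEq ι] [DecidableEq A] [DecidableEq B] in
/-- the generating function is the evaluation of the polynomial `genPolyX`. [cite: BalabanImbrieJaffe1988, p.291] -/
theorem genFun_eq_eval (N : ℕ) (t : ℝ) : genFun Cl Wl deg N t = (genPolyX Cl Wl deg N).eval t := by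
  simp only [genFun, genPolyX, Polynomial.eval_finsetSum, Polynomial.eval_mul, Polynomial.eval_C, Polynomial.eval_pow,
    Polynomial.eval_X]
  refine Finset.sum_congr rfl fun l _ => ?_
  rw [trace_pow_scaleW, Finset.mul_sum]
  refine Finset.sum_congr rfl fun w _ => ?_
  ring

omit [Fintype ι] [DecidableEq ι] [DecidableEq A] [DecidableEq B] in
/-- at `e′ = 0` (the family at `u_{k+1}`) the generating function vanishes, every letter having order `≥ 1`.
[cite: BalabanImbrieJaffe1988, p.291] -/
theorem genFun_zero (hdeg : ∀ b, 1 ≤ deg b) (N : ℕ) : genFun Cl Wl deg N 0 = 0 := by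
  rw [genFun_eq_eval, ← Polynomial.coeff_zero_eq_eval_zero]
  simp only [genPolyX, Polynomial.finsetSum_coeff, Polynomial.coeff_C_mul_X_pow]
  refine Finset.sum_eq_zero fun l _ => Finset.sum_eq_zero fun w _ => ?_
  have h := le_wdeg deg hdeg (l + 1) w
  rw [if_neg (by omega)]

omit [Fintype ι] [DecidableEq ι] [DecidableEq A] [DecidableEq B] in
/-- **THE `n`-TH COEFFICIENT = THE WORDS OF TOTAL ORDER `n`** (weights `1/2l`):
`coeff n = Σ_{l<N} Σ_{w : wdeg w = n} (1/(2(l+1)))·tr(C_{a₁}W_{b₁}⋯)`. [cite: BalabanImbrieJaffe1988, p.291] -/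
theorem coeff_genPolyX (N n : ℕ) :
    (genPolyX Cl Wl deg N).coeff n =
      ∑ l ∈ Finset.range N, ∑ w ∈ (Finset.univ : Finset (Fin (l + 1) → A × B)).filter (fun w => wdeg deg (l + 1) w = n),
        1 / (2 * ((l : ℝ) + 1)) * (bprod (letter Cl Wl) (l + 1) w).trace := by
  simp only [genPolyX, Polynomial.finsetSum_coeff, Polynomial.coeff_C_mul_X_pow]
  refine Finset.sum_congr rfl fun l _ => ?_
  rw [Finset.sum_filter]
  refine Finset.sum_congr rfl fun w _ => ?_
  by_cases h : wdeg deg (l + 1) w = n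
  · rw [if_pos h.symm, if_pos h]
  · rw [if_neg (Ne.symm h), if_neg h]

omit [Fintype ι] [DecidableEq ι] [DecidableEq A] [DecidableEq B] in
/-- the coefficients of order `n ≤ N` do not depend on the truncation length `N' ≥ N` (words of length `> N` have order `> N`).
[cite: BalabanImbrieJaffe1988, p.291] -/
theorem coeff_genPolyX_eq_of_le (hdeg : ∀ b, 1 ≤ deg b) {n N N' : ℕ} (hn : n ≤ N) (hN : N ≤ N') :
    (genPolyX Cl Wl deg N').coeff n = (genPolyX Cl Wl deg N).coeff n := by
  rw [coeff_genPolyX, coeff_genPolyX]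
  symm
  refine Finset.sum_subset (Finset.range_subset_range.mpr hN) fun l _ hl => ?_
  rw [Finset.mem_range, not_lt] at hl
  refine Finset.sum_eq_zero fun w hw => ?_
  exfalso
  have h := le_wdeg deg hdeg (l + 1) w
  rw [Finset.mem_filter] at hw
  omega

/-- the iterated derivatives of a polynomial function are the evaluations of its iterated formal derivatives. [folklore] -/
private theorem iteratedDeriv_eval (p : ℝ[X]) :
    ∀ n : ℕ, iteratedDeriv n (fun t => p.eval t) = fun t => (Polynomial.derivative^[n] p).eval t
  | 0 => by simp
  | n + 1 => by
      rw [iteratedDeriv_succ', show deriv (fun t => p.eval t) = fun t => (Polynomial.derivative p).eval t from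
        funext fun t => Polynomial.deriv (p := p), iteratedDeriv_eval (Polynomial.derivative p) n,
        Function.iterate_succ_apply]

/-- `dⁿ/dtⁿ p(t)|₀ = n!·coeff n`. [folklore] -/
private theorem iteratedDeriv_eval_zero (p : ℝ[X]) (n : ℕ) :
    iteratedDeriv n (fun t => p.eval t) 0 = n.factorial * p.coeff n := by
  rw [iteratedDeriv_eval]
  show (Polynomial.derivative^[n] p).eval 0 = _
  rw [← Polynomial.coeff_zero_eq_eval_zero, Polynomial.coeff_iterate_derivative, zero_add,
    Nat.descFactorial_self, nsmul_eq_mul]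

omit [Fintype ι] [DecidableEq ι] [DecidableEq A] [DecidableEq B] in
/-- **THE TAYLOR COEFFICIENTS OF THE GENERATING FUNCTION**: `[dⁿ/de′ⁿ genFun N]_{e′=0} = n!·coeff n`, i.e.
`(1/n!)·dⁿ/de′ⁿ|₀` of *"(5.7.4) for log Z"* along the family collects exactly the words of total order `n`.
[cite: BalabanImbrieJaffe1988, p.291] -/
theorem iteratedDeriv_genFun_zero (N n : ℕ) :
    iteratedDeriv n (genFun Cl Wl deg N) 0 = n.factorial * (genPolyX Cl Wl deg N).coeff n := by
  have h : genFun Cl Wl deg N = fun t => (genPolyX Cl Wl deg N).eval t := funext (genFun_eq_eval Cl Wl deg N)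
  rw [h, iteratedDeriv_eval_zero]

end Generating

/-! ## §3 The p. 291 display: the separated words ARE the Taylor sum -/

section Display

variable (Cl : A → Matrix T T ℝ) (sC : A → Finset ι) (Wl : B → Matrix T T ℝ) (sW : B → Finset ι) (deg : B → ℕ)

/-- reindexing `Σ_{n=1}^{n̄} f n = Σ_{n<n̄} f (n+1)`. [folklore] -/
private theorem sum_Icc_one_eq_sum_range (f : ℕ → ℝ) (nbar : ℕ) :
    ∑ n ∈ Finset.Icc 1 nbar, f n = ∑ n ∈ Finset.range nbar, f (n + 1) := by
  rw [← Finset.Ico_add_one_right_eq_Icc, Finset.sum_Ico_eq_sum_range, Nat.add_sub_cancel]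
  exact Finset.sum_congr rfl fun n _ => by rw [add_comm]

omit [DecidableEq A] [DecidableEq B] in
/-- **THE p. 291 DISPLAY, PROVED ON THE MODEL** — *"In terms with l ≤ n̄ we separate from (1/2l) tr(C^{(j)}_{Λ₁₀^{(j)}}(u_{k+1})
W^{(j,n̄)}) the terms of order ≤ n̄ in e_j. We can write the sum of all these terms as Σ_{n=1}^{n̄} (1/n!) [dⁿ/de′ⁿ
log Z^{(j)}_{Λ₁₀^{(j)}}(u_{k+1} exp(ie′e_jζÃ̃^ζ))]_{e′=0}"*: with every letter of order `≥ 1` and `log Z` along the family given by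
its series (5.7.4) through the words of length `≤ N`, `N ≥ n̄` (*"using (5.7.4) for log Z"*, p. 292), the separated part
`LOW = Σ_{l<n̄} Σ_X (1/(2(l+1)))·wlen (l+1) (order ≤ n̄) X` of `BIJ88Eq5713Localized.prod_Z49_eq5713_order` equals
`Σ_{n<n̄} (1/(n+1)!)·[d^{n+1}/de′^{n+1} genFun N]_{e′=0}`. [cite: BalabanImbrieJaffe1988, p.291] -/
theorem lowWords_eq_taylor (hdeg : ∀ b, 1 ≤ deg b) {nbar N : ℕ} (hN : nbar ≤ N) :
    ∑ l ∈ Finset.range nbar, ∑ X : Finset ι, 1 / (2 * ((l : ℝ) + 1)) *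
        wlen Cl sC Wl sW (l + 1) (fun w => ¬ (nbar + 1 ≤ ∑ i, deg (w i).2)) X =
      ∑ n ∈ Finset.range nbar, 1 / ((n + 1).factorial : ℝ) * iteratedDeriv (n + 1) (genFun Cl Wl deg N) 0 := by
  classical
  have hwd : ∀ (l : ℕ) (w : Fin (l + 1) → A × B), l + 1 ≤ wdeg deg (l + 1) w := fun l w => le_wdeg deg hdeg (l + 1) w
  have hR : ∀ n ∈ Finset.range nbar, 1 / ((n + 1).factorial : ℝ) * iteratedDeriv (n + 1) (genFun Cl Wl deg N) 0 =
      (genPolyX Cl Wl deg N).coeff (n + 1) := by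
    intro n _
    rw [iteratedDeriv_genFun_zero]
    have h : ((n + 1).factorial : ℝ) ≠ 0 := by positivity
    field_simp
  rw [Finset.sum_congr rfl hR]
  simp_rw [coeff_genPolyX]
  conv_rhs => rw [Finset.sum_comm]
  rw [← Finset.sum_subset (Finset.range_subset_range.mpr hN)]
  · refine Finset.sum_congr rfl fun l hl => ?_
    have hl' : l < nbar := Finset.mem_range.mp hl
    rw [← Finset.mul_sum, ← sum_words_eq_sum_hulls, Finset.mul_sum]
    symm
    rw [← Finset.sum_fiberwise_of_maps_to (s := Finset.univ.filter fun w : Fin (l + 1) → A × B =>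
        ¬ (nbar + 1 ≤ ∑ i, deg (w i).2)) (t := Finset.range nbar) (g := fun w => wdeg deg (l + 1) w - 1) ?_]
    · refine Finset.sum_congr rfl fun n hn => Finset.sum_congr ?_ fun _ _ => rfl
      have hn' : n < nbar := Finset.mem_range.mp hn
      ext w
      have hw := hwd l w
      simp only [Finset.mem_filter, Finset.mem_univ, true_and]
      unfold wdeg at hw ⊢
      omega
    · intro w hw
      rw [Finset.mem_filter] at hw
      rw [Finset.mem_range]
      have hw' := hwd l w
      unfold wdeg at hw' ⊢
      omega
  · intro l hlN hln
    rw [Finset.mem_range, not_lt] at hln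
    refine Finset.sum_eq_zero fun n hn => Finset.sum_eq_zero fun w hw => ?_
    exfalso
    rw [Finset.mem_filter] at hw
    rw [Finset.mem_range] at hn
    have hw' := hwd l w
    omega

omit [DecidableEq A] [DecidableEq B] in
/-- The same with the print's indexation `Σ_{n=1}^{n̄} (1/n!)·dⁿ/de′ⁿ|₀`. [cite: BalabanImbrieJaffe1988, p.291] -/
theorem lowWords_eq_taylor_Icc (hdeg : ∀ b, 1 ≤ deg b) {nbar N : ℕ} (hN : nbar ≤ N) :
    ∑ l ∈ Finset.range nbar, ∑ X : Finset ι, 1 / (2 * ((l : ℝ) + 1)) *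
        wlen Cl sC Wl sW (l + 1) (fun w => ¬ (nbar + 1 ≤ ∑ i, deg (w i).2)) X =
      ∑ n ∈ Finset.Icc 1 nbar, 1 / (n.factorial : ℝ) * iteratedDeriv n (genFun Cl Wl deg N) 0 := by
  rw [lowWords_eq_taylor Cl sC Wl sW deg hdeg hN,
    sum_Icc_one_eq_sum_range (fun n => 1 / (n.factorial : ℝ) * iteratedDeriv n (genFun Cl Wl deg N) 0)]

end Display

/-! ## §4 Hand-over to the resummation (5.7.10): `lowOrder Φ n̄ S = LOW` -/

section HandOver

variable (Cl : A → Matrix T T ℝ) (sC : A → Finset ι) (Wl : B → Matrix T T ℝ) (sW : B → Finset ι) (deg : B → ℕ)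
variable {L : Type*} [Fintype L] [DecidableEq L] [LinearOrder L]

/-- derivatives of positive order ignore an additive constant. [folklore] -/
private theorem iteratedDeriv_add_const_succ (F : ℝ → ℝ) (c : ℝ) (n : ℕ) :
    iteratedDeriv (n + 1) (fun t => F t + c) = iteratedDeriv (n + 1) F := by
  rw [iteratedDeriv_succ', iteratedDeriv_succ', deriv_add_const']

omit [DecidableEq A] [DecidableEq B] [LinearOrder L] in
/-- **THE SEPARATED WORDS FEED (5.7.10)** — for a function `Φ` of the scale parameters `(e′_l)_{l∈S}` (print:
`log Z^{(j)}_{Λ₁₀^{(j)}}(u_{k+1} exp(ie_jζ Σ_l e′_lÃ̃_l))`, `C^{n̄}`) whose DIAGONAL — all scales switched on together, i.e. the one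
field `Ã̃ = Σ_l Ã̃_l` of p. 291 — is `t ↦ log Z^{(j)}(u_{k+1}) + genFun N t` (*"using (5.7.4) for log Z"*), the low-order terms of
p. 292's first display equal the separated words: `BIJ88Resummation5710.lowOrder Φ n̄ S = LOW` (then `eq5710` regroups them by
the minimal scale). [cite: BalabanImbrieJaffe1988, p.291, (5.7.10) p.292] -/
theorem lowOrder_eq_lowWords (hdeg : ∀ b, 1 ≤ deg b) {Φ : (L → ℝ) → ℝ} {nbar N : ℕ} (hN : nbar ≤ N)
    (hΦ : ContDiff ℝ nbar Φ) (S : Finset L) (c : ℝ)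
    (hdiag : ∀ t : ℝ, Φ (t • ∑ l ∈ S, (Pi.single l (1 : ℝ) : L → ℝ)) = genFun Cl Wl deg N t + c) :
    lowOrder Φ nbar S =
      ∑ l ∈ Finset.range nbar, ∑ X : Finset ι, 1 / (2 * ((l : ℝ) + 1)) *
        wlen Cl sC Wl sW (l + 1) (fun w => ¬ (nbar + 1 ≤ ∑ i, deg (w i).2)) X := by
  rw [lowOrder_eq_sum_iteratedDeriv hΦ S, funext hdiag, lowWords_eq_taylor Cl sC Wl sW deg hdeg hN,
    sum_Icc_one_eq_sum_range (fun n => 1 / (n.factorial : ℝ) * iteratedDeriv n (fun t => genFun Cl Wl deg N t + c) 0)]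
  refine Finset.sum_congr rfl fun n _ => ?_
  rw [iteratedDeriv_add_const_succ]

end HandOver

/-! ## §5 Hand-over to the perturbative functional of (5.6.14)/(5.7.15): `pertP (genFun N) n̄ = −LOW` -/

section PertP

variable (Cl : A → Matrix T T ℝ) (sC : A → Finset ι) (Wl : B → Matrix T T ℝ) (sW : B → Finset ι) (deg : B → ℕ)

omit [Fintype ι] [DecidableEq ι] [DecidableEq A] [DecidableEq B] in
/-- the generating function is smooth (a polynomial). [cite: BalabanImbrieJaffe1988, p.291] -/
theorem contDiff_genFun (N : ℕ) {m : WithTop ℕ∞} : ContDiff ℝ m (genFun Cl Wl deg N) := by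
  have h : genFun Cl Wl deg N = fun t => (genPolyX Cl Wl deg N).eval t := funext (genFun_eq_eval Cl Wl deg N)
  rw [h]
  simpa only [Polynomial.coe_aeval_eq_eval] using (genPolyX Cl Wl deg N).contDiff_aeval (𝕜 := ℝ) m

omit [DecidableEq A] [DecidableEq B] in
/-- **THE SEPARATED WORDS OF ONE SCALE ARE `−𝒫` OF THE GENERATING FUNCTION** — with the sign and Taylor weights of the print's
perturbative functional ((5.6.14) `pertP`, (5.7.15) `pertQ5715 = pertP (logZ …)`): `pertP (genFun N) n̄ = −LOW` for `N ≥ n̄`,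
letters of order `≥ 1` — the one-scale instance of *"feeding the low-order words into Q^{(k)}"* (the multi-scale bookkeeping is
(5.7.10), `lowOrder_eq_lowWords` + `BIJ88Resummation5710.eq5710`). [cite: BalabanImbrieJaffe1988, p.291, (5.7.15) p.295] -/
theorem pertP_genFun_eq_neg_lowWords (hdeg : ∀ b, 1 ≤ deg b) {nbar N : ℕ} (hN : nbar ≤ N) :
    BIJ88Sect5StatementsPart4.pertP (genFun Cl Wl deg N) nbar =
      -∑ l ∈ Finset.range nbar, ∑ X : Finset ι, 1 / (2 * ((l : ℝ) + 1)) *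
        wlen Cl sC Wl sW (l + 1) (fun w => ¬ (nbar + 1 ≤ ∑ i, deg (w i).2)) X := by
  rw [BIJ88LeadGroupCompose294.pertP_eq_neg_taylor (contDiff_genFun Cl Wl deg N),
    lowWords_eq_taylor Cl sC Wl sW deg hdeg hN]

end PertP


/-! ## §6 *"using (5.7.4) for log Z"* IN FULL: the whole series along the family is the power series of the words -/

section Series

open BIJ88TraceTermsBound579 (norm_bprod_le)
open BIJ88Normalization46 (Z49 Z49_pos)
open BIJ88TraceLog574 (Z49_eq574)
open scoped Topology ENNReal NNReal

variable (Cl : A → Matrix T T ℝ) (sC : A → Finset ι) (Wl : B → Matrix T T ℝ) (sW : B → Finset ι) (deg : B → ℕ)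

/-- **THE FULL SERIES (5.7.4) ALONG THE FAMILY**: `genSeries e′ = Σ_{l≥1} (1/2l)·tr((C W(e′))^l)` — by p02's
`BIJ88TraceLog574.Z49_eq574` this is `log Z^{(j)}(u_{k+1}exp(ie′e_jζÃ̃)) − log Z^{(j)}(u_{k+1})` for the typed normalization factor
(4.9) whenever the smallness of (5.7.4) holds at `e′` (`genSeries_eq_log_Z49`). [cite: BalabanImbrieJaffe1988, (5.7.4) p.289, p.291] -/
noncomputable def genSeries (t : ℝ) : ℝ :=
  ∑' l : ℕ, 1 / (2 * ((l : ℝ) + 1)) * (((∑ a, Cl a) * (∑ b, scaleW Wl deg t b)) ^ (l + 1)).trace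

/-- THE WORDS OF TOTAL ORDER `n` (weights `1/2l`): the `n`-th coefficient of the generating polynomial through the words of
length `≤ n` (= of any longer truncation, `coeff_genPolyX_eq_of_le`). [cite: BalabanImbrieJaffe1988, p.291] -/
noncomputable def lowCoeff (n : ℕ) : ℝ := (genPolyX Cl Wl deg n).coeff n

/-- an entry of a real kernel is at most its `ℓ^∞`-operator norm. [folklore] -/
private theorem abs_apply_le_norm (M : Matrix T T ℝ) (i j : T) : |M i j| ≤ ‖M‖ := by
  rw [Matrix.linfty_opNorm_def]
  have h1 : (‖M i j‖₊ : NNReal) ≤ ∑ j', ‖M i j'‖₊ :=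
    Finset.single_le_sum (f := fun j' => ‖M i j'‖₊) (fun _ _ => zero_le) (Finset.mem_univ j)
  have h2 : (∑ j', ‖M i j'‖₊ : NNReal) ≤ Finset.univ.sup fun i' => ∑ j', ‖M i' j'‖₊ :=
    Finset.le_sup (f := fun i' => ∑ j', ‖M i' j'‖₊) (Finset.mem_univ i)
  have h := NNReal.coe_le_coe.mpr (h1.trans h2)
  rw [coe_nnnorm, Real.norm_eq_abs] at h
  exact h

/-- `|tr M| ≤ |T|·‖M‖`. [folklore] -/
private theorem abs_trace_le (M : Matrix T T ℝ) : |M.trace| ≤ Fintype.card T * ‖M‖ := by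
  unfold Matrix.trace
  calc |∑ i, Matrix.diag M i| ≤ ∑ i, |Matrix.diag M i| := Finset.abs_sum_le_sum_abs _ _
    _ ≤ ∑ _i : T, ‖M‖ := Finset.sum_le_sum fun i _ => abs_apply_le_norm M i i
    _ = Fintype.card T * ‖M‖ := by rw [Finset.sum_const, nsmul_eq_mul, Finset.card_univ]

omit [Fintype ι] [DecidableEq ι] [DecidableEq A] [DecidableEq B] in
/-- the crude bound on all the words of one length: `Σ_w |tr(C_{a₁}W_{b₁}⋯)| ≤ |T|·(N_C N_W)^{l}`, `N_C = Σ_a ‖C_a‖`,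
`N_W = Σ_b ‖W_b‖`. [cite: BalabanImbrieJaffe1988, (5.7.4) p.289] -/
theorem sum_abs_trace_words_le (l : ℕ) :
    ∑ w : Fin (l + 1) → A × B, |(bprod (letter Cl Wl) (l + 1) w).trace| ≤
      Fintype.card T * ((∑ a, ‖Cl a‖) * (∑ b, ‖Wl b‖)) ^ (l + 1) := by
  have hf : ((∑ a, ‖Cl a‖) * (∑ b, ‖Wl b‖)) ^ (l + 1) =
      ∑ w : Fin (l + 1) → A × B, ∏ i, (‖Cl (w i).1‖ * ‖Wl (w i).2‖) := by
    rw [show (∑ a, ‖Cl a‖) * (∑ b, ‖Wl b‖) = ∑ p : A × B, ‖Cl p.1‖ * ‖Wl p.2‖ by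
      rw [Finset.sum_mul_sum, Fintype.sum_prod_type], Finset.sum_pow', Fintype.piFinset_univ]
  rw [hf, Finset.mul_sum]
  refine Finset.sum_le_sum fun w _ => ?_
  exact (abs_trace_le _).trans (mul_le_mul_of_nonneg_left (norm_bprod_le l w) (Nat.cast_nonneg _))

/-- the terms of the double series (length `l+1`, order `n`): `(Σ_{w : wdeg w = n} (1/(2(l+1)))·tr(…))·t^n`.
[cite: BalabanImbrieJaffe1988, (5.7.4) p.289, p.291] -/
private noncomputable def term (t : ℝ) (p : ℕ × ℕ) : ℝ :=
  (∑ w ∈ (Finset.univ : Finset (Fin (p.1 + 1) → A × B)).filter (fun w => wdeg deg (p.1 + 1) w = p.2),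
    1 / (2 * ((p.1 : ℝ) + 1)) * (bprod (letter Cl Wl) (p.1 + 1) w).trace) * t ^ p.2

omit [Fintype ι] [DecidableEq ι] [DecidableEq A] [DecidableEq B] in
/-- rows: for fixed length the orders sum to the `l`-th term of (5.7.4) along the family.
[cite: BalabanImbrieJaffe1988, (5.7.4) p.289, p.291] -/
private theorem hasSum_row (t : ℝ) (l : ℕ) :
    HasSum (fun n => term Cl Wl deg t (l, n))
      (1 / (2 * ((l : ℝ) + 1)) * (((∑ a, Cl a) * (∑ b, scaleW Wl deg t b)) ^ (l + 1)).trace) := by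
  classical
  have hzero : ∀ n ∉ (Finset.univ : Finset (Fin (l + 1) → A × B)).image (wdeg deg (l + 1)), term Cl Wl deg t (l, n) = 0 := by
    intro n hn
    unfold term
    dsimp only
    rw [Finset.sum_eq_zero fun w hw => ?_, zero_mul]
    exfalso
    exact hn (Finset.mem_image.mpr ⟨w, Finset.mem_univ _, (Finset.mem_filter.mp hw).2⟩)
  have h : HasSum (fun n => term Cl Wl deg t (l, n))
      (∑ n ∈ (Finset.univ : Finset (Fin (l + 1) → A × B)).image (wdeg deg (l + 1)), term Cl Wl deg t (l, n)) :=
    hasSum_sum_of_ne_finset_zero hzero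
  have hval : ∑ n ∈ (Finset.univ : Finset (Fin (l + 1) → A × B)).image (wdeg deg (l + 1)), term Cl Wl deg t (l, n) =
      1 / (2 * ((l : ℝ) + 1)) * (((∑ a, Cl a) * (∑ b, scaleW Wl deg t b)) ^ (l + 1)).trace := by
    rw [trace_pow_scaleW, Finset.mul_sum]
    unfold term
    dsimp only
    simp only [Finset.sum_mul]
    calc ∑ n ∈ (Finset.univ : Finset (Fin (l + 1) → A × B)).image (wdeg deg (l + 1)),
          ∑ w ∈ Finset.univ.filter (fun w => wdeg deg (l + 1) w = n),
            1 / (2 * ((l : ℝ) + 1)) * (bprod (letter Cl Wl) (l + 1) w).trace * t ^ n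
        = ∑ n ∈ (Finset.univ : Finset (Fin (l + 1) → A × B)).image (wdeg deg (l + 1)),
          ∑ w ∈ Finset.univ.filter (fun w => wdeg deg (l + 1) w = n),
            1 / (2 * ((l : ℝ) + 1)) * (bprod (letter Cl Wl) (l + 1) w).trace * t ^ wdeg deg (l + 1) w :=
          Finset.sum_congr rfl fun n _ => Finset.sum_congr rfl fun w hw => by rw [(Finset.mem_filter.mp hw).2]
      _ = ∑ w : Fin (l + 1) → A × B,
            1 / (2 * ((l : ℝ) + 1)) * (bprod (letter Cl Wl) (l + 1) w).trace * t ^ wdeg deg (l + 1) w :=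
          Finset.sum_fiberwise_of_maps_to (fun w _ => Finset.mem_image_of_mem _ (Finset.mem_univ w)) _
      _ = _ := Finset.sum_congr rfl fun w _ => by ring
  rwa [hval] at h

omit [Fintype ι] [DecidableEq ι] [DecidableEq A] [DecidableEq B] in
/-- columns: for fixed order `n` only the lengths `≤ n` contribute, and they sum to `lowCoeff n · t^n`.
[cite: BalabanImbrieJaffe1988, (5.7.4) p.289, p.291] -/
private theorem hasSum_col (hdeg : ∀ b, 1 ≤ deg b) (t : ℝ) (n : ℕ) :
    HasSum (fun l => term Cl Wl deg t (l, n)) (lowCoeff Cl Wl deg n * t ^ n) := by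
  have hzero : ∀ l ∉ Finset.range n, term Cl Wl deg t (l, n) = 0 := by
    intro l hl
    rw [Finset.mem_range, not_lt] at hl
    unfold term
    dsimp only
    rw [Finset.sum_eq_zero fun w hw => ?_, zero_mul]
    exfalso
    have h := le_wdeg deg hdeg (l + 1) w
    rw [Finset.mem_filter] at hw
    omega
  have h : HasSum (fun l => term Cl Wl deg t (l, n)) (∑ l ∈ Finset.range n, term Cl Wl deg t (l, n)) :=
    hasSum_sum_of_ne_finset_zero hzero
  have hval : ∑ l ∈ Finset.range n, term Cl Wl deg t (l, n) = lowCoeff Cl Wl deg n * t ^ n := by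
    rw [lowCoeff, coeff_genPolyX, Finset.sum_mul]
    rfl
  rwa [hval] at h

omit [Fintype ι] [DecidableEq ι] [DecidableEq A] [DecidableEq B] in
/-- one row of absolute values is at most `(|T|/2)·θ^{l+1}` for `|t| ≤ 1`, `θ = N_C N_W`.
[cite: BalabanImbrieJaffe1988, (5.7.4) p.289, p.291] -/
private theorem sum_abs_term_le {t : ℝ} (ht : |t| ≤ 1) (l : ℕ) (s : Finset ℕ) :
    ∑ n ∈ s, |term Cl Wl deg t (l, n)| ≤
      Fintype.card T / 2 * ((∑ a, ‖Cl a‖) * (∑ b, ‖Wl b‖)) ^ (l + 1) := by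
  classical
  have hr0 : 0 ≤ 1 / (2 * ((l : ℝ) + 1)) := by positivity
  have hr : 1 / (2 * ((l : ℝ) + 1)) ≤ 1 / 2 := by
    refine one_div_le_one_div_of_le (by norm_num) ?_
    have : (0 : ℝ) ≤ l := Nat.cast_nonneg l
    linarith
  -- each term: |term (l,n)| ≤ Σ_{w : wdeg = n} r·|tr|
  have h1 : ∀ n ∈ s, |term Cl Wl deg t (l, n)| ≤
      ∑ w ∈ (Finset.univ : Finset (Fin (l + 1) → A × B)).filter (fun w => wdeg deg (l + 1) w = n),
        1 / (2 * ((l : ℝ) + 1)) * |(bprod (letter Cl Wl) (l + 1) w).trace| := by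
    intro n _
    unfold term
    dsimp only
    rw [abs_mul]
    calc _ ≤ |∑ w ∈ Finset.univ.filter (fun w => wdeg deg (l + 1) w = n),
            1 / (2 * ((l : ℝ) + 1)) * (bprod (letter Cl Wl) (l + 1) w).trace| * 1 :=
          mul_le_mul_of_nonneg_left (by rw [abs_pow]; exact pow_le_one₀ (abs_nonneg t) ht) (abs_nonneg _)
      _ ≤ _ := by
          rw [mul_one]
          refine (Finset.abs_sum_le_sum_abs _ _).trans (le_of_eq (Finset.sum_congr rfl fun w _ => ?_))
          rw [abs_mul, abs_of_nonneg hr0]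
  refine (Finset.sum_le_sum h1).trans ?_
  -- regroup the fibers back into a sum over the words with `wdeg ∈ s`, then enlarge to all words
  rw [Finset.sum_fiberwise_eq_sum_filter]
  calc ∑ w ∈ Finset.univ.filter (fun w : Fin (l + 1) → A × B => wdeg deg (l + 1) w ∈ s),
        1 / (2 * ((l : ℝ) + 1)) * |(bprod (letter Cl Wl) (l + 1) w).trace|
      ≤ ∑ w : Fin (l + 1) → A × B, 1 / (2 * ((l : ℝ) + 1)) * |(bprod (letter Cl Wl) (l + 1) w).trace| :=
        Finset.sum_le_sum_of_subset_of_nonneg (Finset.filter_subset _ _)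
          fun w _ _ => mul_nonneg hr0 (abs_nonneg _)
    _ = 1 / (2 * ((l : ℝ) + 1)) * ∑ w : Fin (l + 1) → A × B, |(bprod (letter Cl Wl) (l + 1) w).trace| := by
        rw [Finset.mul_sum]
    _ ≤ 1 / 2 * (Fintype.card T * ((∑ a, ‖Cl a‖) * (∑ b, ‖Wl b‖)) ^ (l + 1)) :=
        mul_le_mul hr (sum_abs_trace_words_le Cl Wl l) (Finset.sum_nonneg fun w _ => abs_nonneg _) (by norm_num)
    _ = _ := by ring

omit [Fintype ι] [DecidableEq ι] [DecidableEq A] [DecidableEq B] in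
/-- the double series is absolutely summable for `|t| ≤ 1` once `θ = N_C N_W < 1`.
[cite: BalabanImbrieJaffe1988, (5.7.4) p.289, p.291] -/
private theorem summable_term {t : ℝ} (ht : |t| ≤ 1) (hθ : (∑ a, ‖Cl a‖) * (∑ b, ‖Wl b‖) < 1) :
    Summable (term Cl Wl deg t) := by
  classical
  set θ := (∑ a, ‖Cl a‖) * (∑ b, ‖Wl b‖) with hθdef
  have hθ0 : 0 ≤ θ := mul_nonneg (Finset.sum_nonneg fun a _ => norm_nonneg _) (Finset.sum_nonneg fun b _ => norm_nonneg _)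
  refine Summable.of_abs (summable_of_sum_le (fun p => abs_nonneg _) (c := Fintype.card T / 2 * (θ / (1 - θ))) fun u => ?_)
  -- `u ⊆ range L ×ˢ range M`
  set L := u.sup (fun p => p.1) + 1
  set M := u.sup (fun p => p.2) + 1
  have hsub : u ⊆ Finset.range L ×ˢ Finset.range M := by
    intro p hp
    rw [Finset.mem_product, Finset.mem_range, Finset.mem_range]
    exact ⟨Nat.lt_succ_of_le (Finset.le_sup (f := fun p : ℕ × ℕ => p.1) hp),
      Nat.lt_succ_of_le (Finset.le_sup (f := fun p : ℕ × ℕ => p.2) hp)⟩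
  calc ∑ p ∈ u, |term Cl Wl deg t p|
      ≤ ∑ p ∈ Finset.range L ×ˢ Finset.range M, |term Cl Wl deg t p| :=
        Finset.sum_le_sum_of_subset_of_nonneg hsub fun p _ _ => abs_nonneg _
    _ = ∑ l ∈ Finset.range L, ∑ n ∈ Finset.range M, |term Cl Wl deg t (l, n)| := Finset.sum_product _ _ _
    _ ≤ ∑ l ∈ Finset.range L, Fintype.card T / 2 * θ ^ (l + 1) :=
        Finset.sum_le_sum fun l _ => sum_abs_term_le Cl Wl deg ht l _
    _ = Fintype.card T / 2 * ∑ l ∈ Finset.Ico 1 (L + 1), θ ^ l := by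
        rw [Finset.mul_sum, Finset.sum_Ico_eq_sum_range, Nat.add_sub_cancel]
        exact Finset.sum_congr rfl fun l _ => by rw [add_comm 1 l]
    _ ≤ Fintype.card T / 2 * (θ / (1 - θ)) := by
        refine mul_le_mul_of_nonneg_left ?_ (by positivity)
        have h := geom_sum_Ico_le_of_lt_one hθ0 hθ (m := 1) (n := L + 1)
        rwa [pow_one] at h

omit [Fintype ι] [DecidableEq ι] [DecidableEq A] [DecidableEq B] in
/-- **THE SERIES (5.7.4) ALONG THE FAMILY IS THE POWER SERIES OF THE WORDS**: for `|e′| ≤ 1` and `θ = N_C N_W < 1`,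
`Σ_n lowCoeff n · e′ⁿ` sums to `genSeries e′` (regrouping the absolutely convergent double series over (length, order)).
[cite: BalabanImbrieJaffe1988, (5.7.4) p.289, p.291] -/
theorem hasSum_lowCoeff_pow (hdeg : ∀ b, 1 ≤ deg b) {t : ℝ} (ht : |t| ≤ 1)
    (hθ : (∑ a, ‖Cl a‖) * (∑ b, ‖Wl b‖) < 1) :
    HasSum (fun n => lowCoeff Cl Wl deg n * t ^ n) (genSeries Cl Wl deg t) := by
  obtain ⟨s, hs⟩ := summable_term Cl Wl deg ht hθ
  have hrows : HasSum (fun l : ℕ => 1 / (2 * ((l : ℝ) + 1)) *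
      (((∑ a, Cl a) * (∑ b, scaleW Wl deg t b)) ^ (l + 1)).trace) s :=
    hs.prod_fiberwise fun l => hasSum_row Cl Wl deg t l
  have hcols : HasSum (fun n => lowCoeff Cl Wl deg n * t ^ n) s :=
    ((Equiv.prodComm ℕ ℕ).hasSum_iff.mpr hs).prod_fiberwise fun n => hasSum_col Cl Wl deg hdeg t n
  rwa [genSeries, hrows.tsum_eq]

omit [Fintype ι] [DecidableEq ι] [DecidableEq A] [DecidableEq B] in
/-- the coefficients are uniformly bounded: `|lowCoeff n| ≤ (|T|/2)·θ/(1−θ)`. [cite: BalabanImbrieJaffe1988, p.291] -/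
theorem abs_lowCoeff_le (hθ : (∑ a, ‖Cl a‖) * (∑ b, ‖Wl b‖) < 1) (n : ℕ) :
    |lowCoeff Cl Wl deg n| ≤
      Fintype.card T / 2 * ((∑ a, ‖Cl a‖) * (∑ b, ‖Wl b‖) / (1 - (∑ a, ‖Cl a‖) * (∑ b, ‖Wl b‖))) := by
  classical
  set θ := (∑ a, ‖Cl a‖) * (∑ b, ‖Wl b‖) with hθdef
  have hθ0 : 0 ≤ θ := mul_nonneg (Finset.sum_nonneg fun a _ => norm_nonneg _) (Finset.sum_nonneg fun b _ => norm_nonneg _)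
  have h1 : |lowCoeff Cl Wl deg n| ≤ ∑ l ∈ Finset.range n, |term Cl Wl deg 1 (l, n)| := by
    rw [lowCoeff, coeff_genPolyX]
    refine (Finset.abs_sum_le_sum_abs _ _).trans (le_of_eq (Finset.sum_congr rfl fun l _ => ?_))
    simp [term]
  refine h1.trans ?_
  calc ∑ l ∈ Finset.range n, |term Cl Wl deg 1 (l, n)|
      ≤ ∑ l ∈ Finset.range n, Fintype.card T / 2 * θ ^ (l + 1) :=
        Finset.sum_le_sum fun l _ => by
          simpa using sum_abs_term_le Cl Wl deg (t := 1) (by simp) l {n}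
    _ = Fintype.card T / 2 * ∑ l ∈ Finset.Ico 1 (n + 1), θ ^ l := by
        rw [Finset.mul_sum, Finset.sum_Ico_eq_sum_range, Nat.add_sub_cancel]
        exact Finset.sum_congr rfl fun l _ => by rw [add_comm 1 l]
    _ ≤ Fintype.card T / 2 * (θ / (1 - θ)) := by
        refine mul_le_mul_of_nonneg_left ?_ (by positivity)
        have h := geom_sum_Ico_le_of_lt_one hθ0 hθ (m := 1) (n := n + 1)
        rwa [pow_one] at h

omit [Fintype ι] [DecidableEq ι] [DecidableEq A] [DecidableEq B] in
/-- **THE POWER SERIES OF `log Z` ALONG THE FAMILY**: for `θ = N_C N_W < 1` the series (5.7.4) along the family has, at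
`e′ = 0`, the power series expansion `Σ_n lowCoeff n · e′ⁿ` on the unit ball (coefficients = the words of total order `n`).
[cite: BalabanImbrieJaffe1988, (5.7.4) p.289, p.291] -/
theorem hasFPowerSeriesOnBall_genSeries (hdeg : ∀ b, 1 ≤ deg b)
    (hθ : (∑ a, ‖Cl a‖) * (∑ b, ‖Wl b‖) < 1) :
    HasFPowerSeriesOnBall (genSeries Cl Wl deg)
      (FormalMultilinearSeries.ofScalars ℝ (lowCoeff Cl Wl deg)) 0 1 where
  r_le := by
    refine le_trans (le_of_eq ENNReal.coe_one.symm)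
      (FormalMultilinearSeries.le_radius_of_bound _
        (Fintype.card T / 2 * ((∑ a, ‖Cl a‖) * (∑ b, ‖Wl b‖) / (1 - (∑ a, ‖Cl a‖) * (∑ b, ‖Wl b‖)))) fun n => ?_)
    rw [FormalMultilinearSeries.ofScalars_norm, NNReal.coe_one, one_pow, mul_one, Real.norm_eq_abs]
    exact abs_lowCoeff_le Cl Wl deg hθ n
  r_pos := zero_lt_one
  hasSum := by
    intro y hy
    have hy' : ‖y‖ < 1 := by
      rw [Metric.mem_eball, edist_zero_right, enorm_eq_nnnorm, ENNReal.coe_lt_one_iff] at hy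
      exact_mod_cast hy
    simp only [FormalMultilinearSeries.ofScalars_apply_eq, smul_eq_mul, zero_add]
    rw [Real.norm_eq_abs] at hy'
    exact hasSum_lowCoeff_pow Cl Wl deg hdeg hy'.le hθ

omit [Fintype ι] [DecidableEq ι] [DecidableEq A] [DecidableEq B] in
/-- **THE TAYLOR COEFFICIENTS OF THE FULL SERIES ARE THE WORDS OF ORDER `n`**: `[dⁿ/de′ⁿ genSeries]_{e′=0} = n!·lowCoeff n`.
[cite: BalabanImbrieJaffe1988, p.291] -/
theorem iteratedDeriv_genSeries_zero (hdeg : ∀ b, 1 ≤ deg b) (hθ : (∑ a, ‖Cl a‖) * (∑ b, ‖Wl b‖) < 1) (n : ℕ) :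
    iteratedDeriv n (genSeries Cl Wl deg) 0 = n.factorial * lowCoeff Cl Wl deg n := by
  have h := (hasFPowerSeriesOnBall_genSeries Cl Wl deg hdeg hθ).factorial_smul 1 n
  rw [iteratedDeriv_eq_iteratedFDeriv, ← h, FormalMultilinearSeries.ofScalars_apply_eq, one_pow, smul_eq_mul, mul_one,
    nsmul_eq_mul]

omit [Fintype ι] [DecidableEq ι] [DecidableEq A] [DecidableEq B] in
/-- … equal to those of every truncation of length `N ≥ n` (READING (r1) of §3 discharged). [cite: BalabanImbrieJaffe1988, p.291] -/
theorem iteratedDeriv_genSeries_eq_genFun (hdeg : ∀ b, 1 ≤ deg b) (hθ : (∑ a, ‖Cl a‖) * (∑ b, ‖Wl b‖) < 1)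
    {n N : ℕ} (hnN : n ≤ N) :
    iteratedDeriv n (genSeries Cl Wl deg) 0 = iteratedDeriv n (genFun Cl Wl deg N) 0 := by
  rw [iteratedDeriv_genSeries_zero Cl Wl deg hdeg hθ, iteratedDeriv_genFun_zero, lowCoeff,
    coeff_genPolyX_eq_of_le Cl Wl deg hdeg le_rfl hnN]

omit [DecidableEq A] [DecidableEq B] in
/-- **THE p. 291 DISPLAY WITH THE FULL SERIES**: `LOW = Σ_{n<n̄} (1/(n+1)!)·[d^{n+1}/de′^{n+1} genSeries]_{e′=0}` for letters of order
`≥ 1` and `θ = N_C N_W < 1`. [cite: BalabanImbrieJaffe1988, p.291] -/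
theorem lowWords_eq_taylor_series (hdeg : ∀ b, 1 ≤ deg b) (hθ : (∑ a, ‖Cl a‖) * (∑ b, ‖Wl b‖) < 1) (nbar : ℕ) :
    ∑ l ∈ Finset.range nbar, ∑ X : Finset ι, 1 / (2 * ((l : ℝ) + 1)) *
        wlen Cl sC Wl sW (l + 1) (fun w => ¬ (nbar + 1 ≤ ∑ i, deg (w i).2)) X =
      ∑ n ∈ Finset.range nbar, 1 / ((n + 1).factorial : ℝ) * iteratedDeriv (n + 1) (genSeries Cl Wl deg) 0 := by
  rw [lowWords_eq_taylor Cl sC Wl sW deg hdeg (le_refl nbar)]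
  refine Finset.sum_congr rfl fun n hn => ?_
  rw [iteratedDeriv_genSeries_eq_genFun Cl Wl deg hdeg hθ (Nat.succ_le_of_lt (Finset.mem_range.mp hn))]

/-! ### The display with `log Z` itself: the typed normalization factor (4.9) along the family -/

omit [Fintype ι] [DecidableEq ι] [DecidableEq A] [DecidableEq B] in
/-- **`log Z^{(j)}(u_{k+1}exp(ie′…)) = log Z^{(j)}(u_{k+1}) + Σ_{l≥1}(1/2l)tr((CW(e′))^l)`** — p02's (5.7.3)–(5.7.4) `Z49_eq574`
in logarithmic form at the parameter `e′`, for the typed normalization factor `Z49` at the inverse covariance `C⁻¹ − W(e′)`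
((5.7.2)), under its hypotheses at `e′`. [cite: BalabanImbrieJaffe1988, (5.7.3)–(5.7.4) p.289, p.291] -/
theorem log_Z49_family_eq {Cinv Sq Sinv : Matrix T T ℝ} (h1 : Sq * Sinv = 1) (h2 : Sinv * Sq = 1)
    (hC : Sinv * Sinv = Cinv) (hSS : Sq * Sq = ∑ a, Cl a) (hCinv : Cinv.PosDef) {t : ℝ}
    (hT : (Cinv - ∑ b, scaleW Wl deg t b).PosDef) (hW : ‖Sq * (∑ b, scaleW Wl deg t b) * Sq‖ < 1) (E N : ℝ) :
    Real.log (Z49 (Cinv - ∑ b, scaleW Wl deg t b) E N) = Real.log (Z49 Cinv E N) + genSeries Cl Wl deg t := by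
  rw [Z49_eq574 h1 h2 hC hSS hCinv hT hW, Real.log_mul (Z49_pos _ hCinv _ _).ne' (Real.exp_pos _).ne', Real.log_exp]
  rfl

/-- derivatives of positive order ignore an additive constant. [folklore] -/
private theorem iteratedDeriv_const_add_succ (F : ℝ → ℝ) (c : ℝ) (n : ℕ) :
    iteratedDeriv (n + 1) (fun t => c + F t) = iteratedDeriv (n + 1) F := by
  rw [iteratedDeriv_succ', iteratedDeriv_succ', deriv_const_add']

omit [Fintype ι] [DecidableEq ι] [DecidableEq A] [DecidableEq B] in
/-- near `e′ = 0`, `log Z49(C⁻¹ − W(e′)) = log Z49(C⁻¹) + genSeries e′` once the smallness of (5.7.3)–(5.7.4) holds for `|e′| < 1`.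
[cite: BalabanImbrieJaffe1988, (5.7.3)–(5.7.4) p.289, p.291] -/
theorem log_Z49_family_eventuallyEq {Cinv Sq Sinv : Matrix T T ℝ} (h1 : Sq * Sinv = 1) (h2 : Sinv * Sq = 1)
    (hC : Sinv * Sinv = Cinv) (hSS : Sq * Sq = ∑ a, Cl a) (hCinv : Cinv.PosDef)
    (hT : ∀ t : ℝ, |t| < 1 → (Cinv - ∑ b, scaleW Wl deg t b).PosDef)
    (hW : ∀ t : ℝ, |t| < 1 → ‖Sq * (∑ b, scaleW Wl deg t b) * Sq‖ < 1) (E N : ℝ) :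
    (fun e' => Real.log (Z49 (Cinv - ∑ b, scaleW Wl deg e' b) E N)) =ᶠ[𝓝 0]
      fun e' => Real.log (Z49 Cinv E N) + genSeries Cl Wl deg e' := by
  have hball : Set.Ioo (-1 : ℝ) 1 ∈ 𝓝 (0 : ℝ) := Ioo_mem_nhds (by norm_num) (by norm_num)
  filter_upwards [hball] with e' he'
  have habs : |e'| < 1 := abs_lt.mpr ⟨he'.1, he'.2⟩
  exact log_Z49_family_eq Cl Wl deg h1 h2 hC hSS hCinv (hT e' habs) (hW e' habs) E N

omit [DecidableEq A] [DecidableEq B] in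
/-- **THE p. 291 DISPLAY, VERBATIM ON THE MODEL** — *"We can write the sum of all these terms as Σ_{n=1}^{n̄} (1/n!)
[dⁿ/de′ⁿ log Z^{(j)}_{Λ₁₀^{(j)}}(u_{k+1} exp(ie′e_jζÃ̃^ζ))]_{e′=0}"*: with `Z^{(j)}` the typed normalization factor (4.9) `Z49` at the
inverse covariance `C⁻¹ − W^{(j)}(e′)` of (5.7.2) along the family (letters of order `≥ 1`, `W_b(e′) = e′^{deg b}W_b`), the smallness of
(5.7.3)–(5.7.4) holding for `|e′| < 1` and `θ = N_C N_W < 1`: the separated words `LOW` of `prod_Z49_eq5713_order` equal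
`Σ_{n<n̄} (1/(n+1)!)·[d^{n+1}/de′^{n+1} log Z49(C⁻¹ − W(e′))]_{e′=0}`. [cite: BalabanImbrieJaffe1988, p.291] -/
theorem lowWords_eq_taylor_logZ49 (hdeg : ∀ b, 1 ≤ deg b) (hθ : (∑ a, ‖Cl a‖) * (∑ b, ‖Wl b‖) < 1)
    {Cinv Sq Sinv : Matrix T T ℝ} (h1 : Sq * Sinv = 1) (h2 : Sinv * Sq = 1) (hC : Sinv * Sinv = Cinv)
    (hSS : Sq * Sq = ∑ a, Cl a) (hCinv : Cinv.PosDef)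
    (hT : ∀ t : ℝ, |t| < 1 → (Cinv - ∑ b, scaleW Wl deg t b).PosDef)
    (hW : ∀ t : ℝ, |t| < 1 → ‖Sq * (∑ b, scaleW Wl deg t b) * Sq‖ < 1) (E N : ℝ) (nbar : ℕ) :
    ∑ l ∈ Finset.range nbar, ∑ X : Finset ι, 1 / (2 * ((l : ℝ) + 1)) *
        wlen Cl sC Wl sW (l + 1) (fun w => ¬ (nbar + 1 ≤ ∑ i, deg (w i).2)) X =
      ∑ n ∈ Finset.range nbar, 1 / ((n + 1).factorial : ℝ) *
        iteratedDeriv (n + 1) (fun e' => Real.log (Z49 (Cinv - ∑ b, scaleW Wl deg e' b) E N)) 0 := by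
  rw [lowWords_eq_taylor_series Cl sC Wl sW deg hdeg hθ nbar]
  refine Finset.sum_congr rfl fun n _ => ?_
  rw [(log_Z49_family_eventuallyEq Cl Wl deg h1 h2 hC hSS hCinv hT hW E N).iteratedDeriv_eq, iteratedDeriv_const_add_succ]

/-! ### … and as `−𝒫` of r16's perturbative functional ((5.6.14)/(5.7.15) shape), smoothness needed at `e′ = 0` only -/

/-- r16's functional with smoothness AT `0` only: `pertP F n̄ = −Σ_{n<n̄} (1/(n+1)!)·F^{(n+1)}(0)` for `F` of class `C^{n̄}` at `0`
(the derivatives within `[0,1]` at `0` are the two-sided ones). [cite: BalabanImbrieJaffe1988, (5.7.15) p.295] -/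
theorem pertP_eq_neg_taylor_of_contDiffAt {F : ℝ → ℝ} {nbar : ℕ} (hF : ContDiffAt ℝ nbar F 0) :
    BIJ88Sect5StatementsPart4.pertP F nbar =
      -∑ n ∈ Finset.range nbar, 1 / ((n + 1).factorial : ℝ) * iteratedDeriv (n + 1) F 0 := by
  rw [BIJ88Sect5StatementsPart4.pertP, ← Finset.sum_neg_distrib]
  refine Finset.sum_congr rfl fun n hn => ?_
  have hn' : n < nbar := Finset.mem_range.mp hn
  have hcd : ContDiffAt ℝ ((n + 1 : ℕ) : WithTop ℕ∞) F 0 := hF.of_le (by exact_mod_cast hn')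
  rw [Set.uIcc_of_le zero_le_one, iteratedDerivWithin_eq_iteratedDeriv (uniqueDiffOn_Icc zero_lt_one) hcd
    (Set.left_mem_Icc.mpr zero_le_one)]
  ring

omit [Fintype ι] [DecidableEq ι] [DecidableEq A] [DecidableEq B] in
/-- the full series is smooth at `e′ = 0` (it is analytic on the unit ball). [cite: BalabanImbrieJaffe1988, (5.7.4) p.289] -/
theorem contDiffAt_genSeries (hdeg : ∀ b, 1 ≤ deg b) (hθ : (∑ a, ‖Cl a‖) * (∑ b, ‖Wl b‖) < 1) {m : WithTop ℕ∞} :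
    ContDiffAt ℝ m (genSeries Cl Wl deg) 0 :=
  (hasFPowerSeriesOnBall_genSeries Cl Wl deg hdeg hθ).analyticAt.contDiffAt

omit [DecidableEq A] [DecidableEq B] in
/-- **`pertP (genSeries) n̄ = −LOW`**: the separated words of one scale are minus r16's perturbative functional ((5.6.14) `pertP`;
(5.7.15) `pertQ5715 = pertP (logZ …)`) of the FULL series (5.7.4) along the family. [cite: BalabanImbrieJaffe1988, p.291, (5.7.15) p.295] -/
theorem pertP_genSeries_eq_neg_lowWords (hdeg : ∀ b, 1 ≤ deg b) (hθ : (∑ a, ‖Cl a‖) * (∑ b, ‖Wl b‖) < 1) (nbar : ℕ) :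
    BIJ88Sect5StatementsPart4.pertP (genSeries Cl Wl deg) nbar =
      -∑ l ∈ Finset.range nbar, ∑ X : Finset ι, 1 / (2 * ((l : ℝ) + 1)) *
        wlen Cl sC Wl sW (l + 1) (fun w => ¬ (nbar + 1 ≤ ∑ i, deg (w i).2)) X := by
  rw [pertP_eq_neg_taylor_of_contDiffAt (contDiffAt_genSeries Cl Wl deg hdeg hθ),
    lowWords_eq_taylor_series Cl sC Wl sW deg hdeg hθ nbar]

omit [DecidableEq A] [DecidableEq B] in
/-- **`−𝒫(log Z^{(j)} along the family) = LOW`** — the perturbative functional of (5.6.14)/(5.7.15) applied to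
`e′ ↦ log Z49(C⁻¹ − W^{(j)}(e′))` (the typed (4.9) factor along `u_{k+1}exp(ie′e_jζÃ̃)`) is minus the separated low-order words:
the one-scale content of *"feeding the low-order words into Q^{(k)}"* with `log Z` itself (smallness of (5.7.3)–(5.7.4) for
`|e′| < 1`, `θ < 1`). [cite: BalabanImbrieJaffe1988, p.291, (5.7.15) p.295] -/
theorem pertP_logZ49_eq_neg_lowWords (hdeg : ∀ b, 1 ≤ deg b) (hθ : (∑ a, ‖Cl a‖) * (∑ b, ‖Wl b‖) < 1)
    {Cinv Sq Sinv : Matrix T T ℝ} (h1 : Sq * Sinv = 1) (h2 : Sinv * Sq = 1) (hC : Sinv * Sinv = Cinv)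
    (hSS : Sq * Sq = ∑ a, Cl a) (hCinv : Cinv.PosDef)
    (hT : ∀ t : ℝ, |t| < 1 → (Cinv - ∑ b, scaleW Wl deg t b).PosDef)
    (hW : ∀ t : ℝ, |t| < 1 → ‖Sq * (∑ b, scaleW Wl deg t b) * Sq‖ < 1) (E N : ℝ) (nbar : ℕ) :
    BIJ88Sect5StatementsPart4.pertP (fun e' => Real.log (Z49 (Cinv - ∑ b, scaleW Wl deg e' b) E N)) nbar =
      -∑ l ∈ Finset.range nbar, ∑ X : Finset ι, 1 / (2 * ((l : ℝ) + 1)) *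
        wlen Cl sC Wl sW (l + 1) (fun w => ¬ (nbar + 1 ≤ ∑ i, deg (w i).2)) X := by
  have hcd : ContDiffAt ℝ (nbar : WithTop ℕ∞) (fun e' => Real.log (Z49 (Cinv - ∑ b, scaleW Wl deg e' b) E N)) 0 :=
    (contDiffAt_const.add (contDiffAt_genSeries Cl Wl deg hdeg hθ)).congr_of_eventuallyEq
      (log_Z49_family_eventuallyEq Cl Wl deg h1 h2 hC hSS hCinv hT hW E N)
  rw [pertP_eq_neg_taylor_of_contDiffAt hcd, lowWords_eq_taylor_logZ49 Cl sC Wl sW deg hdeg hθ h1 h2 hC hSS hCinv hT hW E N nbar]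

end Series


/-! ## §7 The multi-scale word model: the diagonal hypothesis of §4 discharged -/

section MultiScale

variable (Cl : A → Matrix T T ℝ) (sC : A → Finset ι) (sW : B → Finset ι) (deg : B → ℕ)
variable {L : Type*} [Fintype L] [DecidableEq L] [LinearOrder L]
variable (Wp : (b : B) → (Fin (deg b) → L) → Matrix T T ℝ)

/-- THE MULTI-SCALE LETTERS along the family `e′ ↦ u_{k+1} exp(ie_jζ Σ_l e′_lÃ̃_l)` of (5.7.10): a letter `b` of field order `deg b`,
expanded multilinearly in `Ã̃ = Σ_l Ã̃_l` (p. 292: *"Π_{α∈α̲}(θ_{j_α}(1−θ_{j_α+1})w₅A′)_b = Σ_X w_{b,α̲}(X)"*), is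
`W_b(e′) = Σ_{J : Fin (deg b) → L} (Π_α e′_{J α})·W_{b,J}` for its scale pieces `W_{b,J}`. [cite: BalabanImbrieJaffe1988, (5.7.10) p.292] -/
def scaleWMulti (e : L → ℝ) (b : B) : Matrix T T ℝ :=
  ∑ J : Fin (deg b) → L, (∏ α, e (J α)) • Wp b J

/-- the letters SEEN ON THE SCALES `S`: `W̃_b = Σ_{J ∈ S^{deg b}} W_{b,J}` (all the scales of `S` switched on together).
[cite: BalabanImbrieJaffe1988, (5.7.10) p.292] -/
def lettersOn (S : Finset L) (b : B) : Matrix T T ℝ :=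
  ∑ J ∈ Fintype.piFinset (fun _ : Fin (deg b) => S), Wp b J

/-- **THE MULTI-SCALE GENERATING FUNCTION** *"using (5.7.4) for log Z"*: `Φ_N(e′) = Σ_{l ≤ N} (1/2l)·tr((C W(e′))^l)` with the
multi-scale letters — the function `log Z^{(j)}(u_{k+1}exp(ie_jζ Σ_l e′_lÃ̃_l)) − log Z^{(j)}(u_{k+1})` of (5.7.10) on the word model,
through the words of length `≤ N`. [cite: BalabanImbrieJaffe1988, (5.7.4) p.289, (5.7.10) p.292] -/
noncomputable def genFunMulti (N : ℕ) (e : L → ℝ) : ℝ :=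
  ∑ l ∈ Finset.range N, 1 / (2 * ((l : ℝ) + 1)) * (((∑ a, Cl a) * (∑ b, scaleWMulti deg Wp e b)) ^ (l + 1)).trace

omit [Fintype T] [DecidableEq T] [Fintype A] [DecidableEq A] [Fintype B] [DecidableEq B] [LinearOrder L] in
/-- ON THE DIAGONAL `e′ = t·𝟙_S` the multi-scale letter is `t^{deg b}·W̃_b` (a piece with a scale outside `S` is switched off).
[cite: BalabanImbrieJaffe1988, (5.7.10) p.292] -/
theorem scaleWMulti_diag (S : Finset L) (t : ℝ) (b : B) :
    scaleWMulti deg Wp (t • ∑ l ∈ S, (Pi.single l (1 : ℝ) : L → ℝ)) b = scaleW (lettersOn deg Wp S) deg t b := by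
  classical
  unfold scaleWMulti scaleW lettersOn
  have hcoord : ∀ l : L, (t • ∑ l' ∈ S, (Pi.single l' (1 : ℝ) : L → ℝ)) l = if l ∈ S then t else 0 := by
    intro l
    rw [Pi.smul_apply, Finset.sum_apply, smul_eq_mul]
    simp only [Pi.single_apply]
    rw [Finset.sum_ite_eq S l]
    split_ifs <;> simp
  have hprod : ∀ J : Fin (deg b) → L, (∏ α, (t • ∑ l' ∈ S, (Pi.single l' (1 : ℝ) : L → ℝ)) (J α)) =
      if J ∈ Fintype.piFinset (fun _ : Fin (deg b) => S) then t ^ deg b else 0 := by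
    intro J
    simp only [hcoord]
    split_ifs with hJ
    · rw [Finset.prod_congr rfl fun α _ => if_pos (Fintype.mem_piFinset.mp hJ α), Finset.prod_const, Finset.card_univ,
        Fintype.card_fin]
    · have h' : ¬ ∀ α, J α ∈ S := fun h => hJ (Fintype.mem_piFinset.mpr h)
      obtain ⟨α, hα⟩ := not_forall.mp h'
      exact Finset.prod_eq_zero (Finset.mem_univ α) (if_neg hα)
  rw [Finset.sum_congr rfl fun J _ => by rw [hprod J]]
  simp only [ite_smul, zero_smul, Finset.sum_ite_mem, Finset.univ_inter]
  rw [Finset.smul_sum]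

omit [Fintype ι] [DecidableEq ι] [DecidableEq A] [DecidableEq B] [LinearOrder L] in
/-- **THE DIAGONAL OF THE MULTI-SCALE GENERATING FUNCTION IS THE ONE-PARAMETER ONE** for the letters seen on `S`:
`Φ_N(t·𝟙_S) = genFun (W̃) N t` — the hypothesis `hdiag` of `lowOrder_eq_lowWords` holds by construction.
[cite: BalabanImbrieJaffe1988, p.291, (5.7.10) p.292] -/
theorem genFunMulti_diag (N : ℕ) (S : Finset L) (t : ℝ) :
    genFunMulti Cl deg Wp N (t • ∑ l ∈ S, (Pi.single l (1 : ℝ) : L → ℝ)) = genFun Cl (lettersOn deg Wp S) deg N t := by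
  unfold genFunMulti genFun
  simp only [scaleWMulti_diag]

omit [Fintype ι] [DecidableEq ι] [DecidableEq A] [DecidableEq B] [DecidableEq L] [LinearOrder L] in
/-- the multi-scale generating function is smooth (a polynomial in the `e′_l`). [cite: BalabanImbrieJaffe1988, (5.7.10) p.292] -/
theorem contDiff_genFunMulti (N : ℕ) {m : WithTop ℕ∞} : ContDiff ℝ m (genFunMulti Cl deg Wp N) := by
  unfold genFunMulti
  have hW : ContDiff ℝ m (fun e : L → ℝ => ∑ b, scaleWMulti deg Wp e b) := by
    refine ContDiff.sum fun b _ => ?_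
    unfold scaleWMulti
    refine ContDiff.sum fun J _ => ?_
    exact (contDiff_prod fun α _ => contDiff_apply ℝ ℝ (J α)).smul contDiff_const
  have hM : ContDiff ℝ m (fun e : L → ℝ => (∑ a, Cl a) * (∑ b, scaleWMulti deg Wp e b)) := contDiff_const.mul hW
  refine ContDiff.sum fun l _ => contDiff_const.mul ?_
  have htr : ContDiff ℝ m (fun M : Matrix T T ℝ => M.trace) :=
    (Matrix.traceLinearMap T ℝ ℝ).toContinuousLinearMap.contDiff
  exact htr.comp (hM.pow (l + 1))

omit [DecidableEq A] [DecidableEq B] [LinearOrder L] in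
/-- **THE LOW-ORDER TERMS OF (5.7.10) ARE THE SEPARATED WORDS, HYPOTHESIS-FREE ON THE MULTI-SCALE WORD MODEL**:
`lowOrder (Φ_N) n̄ S = LOW(W̃)` for the multi-scale generating function and the letters seen on `S` (`N ≥ n̄`, orders `≥ 1`), so that
`BIJ88Resummation5710.eq5710` regroups exactly the separated words of `prod_Z49_eq5713_order` by their minimal scale.
[cite: BalabanImbrieJaffe1988, p.291, (5.7.10) p.292] -/
theorem lowOrder_genFunMulti (hdeg : ∀ b, 1 ≤ deg b) {nbar N : ℕ} (hN : nbar ≤ N) (S : Finset L) :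
    lowOrder (genFunMulti Cl deg Wp N) nbar S =
      ∑ l ∈ Finset.range nbar, ∑ X : Finset ι, 1 / (2 * ((l : ℝ) + 1)) *
        wlen Cl sC (lettersOn deg Wp S) sW (l + 1) (fun w => ¬ (nbar + 1 ≤ ∑ i, deg (w i).2)) X :=
  lowOrder_eq_lowWords Cl sC (lettersOn deg Wp S) sW deg hdeg hN (contDiff_genFunMulti Cl deg Wp N) S 0
    fun t => by rw [genFunMulti_diag, add_zero]

omit [DecidableEq A] [DecidableEq B] in
/-- … hence **(5.7.10) FOR THE WORDS**: the separated words equal the sum over `m ∈ S` of the `m`-th groups of the multi-scale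
generating function (`eq5710`). [cite: BalabanImbrieJaffe1988, (5.7.10) p.292] -/
theorem lowWords_eq_sum_leadGroup (hdeg : ∀ b, 1 ≤ deg b) {nbar N : ℕ} (hN : nbar ≤ N) (S : Finset L) :
    ∑ l ∈ Finset.range nbar, ∑ X : Finset ι, 1 / (2 * ((l : ℝ) + 1)) *
        wlen Cl sC (lettersOn deg Wp S) sW (l + 1) (fun w => ¬ (nbar + 1 ≤ ∑ i, deg (w i).2)) X =
      ∑ m ∈ S, BIJ88Resummation5710.leadGroup (genFunMulti Cl deg Wp N) nbar S m := by
  rw [← lowOrder_genFunMulti Cl sC sW deg Wp hdeg hN S, BIJ88Resummation5710.eq5710]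


omit [DecidableEq A] [DecidableEq B] in
/-- **THE TOP GROUP OF THE MULTI-SCALE GENERATING FUNCTION** — for the maximal scale `k` of `S`: the `k`-th group of (5.7.10) is
the separated low-order words of the letters seen on the scale `k` ALONE (its one-parameter function `t ↦ Φ_N(t·e_k)` is their
generating function; `BIJ88LeadGroupCompose294.leadGroup_max_eq_neg_pertP` + `pertP_genFun_eq_neg_lowWords`) — the words that
p. 295 sends to `Q^{(k)}` (*"The term m = k … in the field θ_kH_{k,loc}A^{(k)}"*). [cite: BalabanImbrieJaffe1988, (5.7.10) p.292, (5.7.15) p.295] -/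
theorem leadGroup_max_genFunMulti (hdeg : ∀ b, 1 ≤ deg b) {nbar N : ℕ} (hN : nbar ≤ N) {S : Finset L} {k : L}
    (hk : k ∈ S) (hmax : ∀ l ∈ S, l ≤ k) :
    BIJ88Resummation5710.leadGroup (genFunMulti Cl deg Wp N) nbar S k =
      ∑ l ∈ Finset.range nbar, ∑ X : Finset ι, 1 / (2 * ((l : ℝ) + 1)) *
        wlen Cl sC (lettersOn deg Wp {k}) sW (l + 1) (fun w => ¬ (nbar + 1 ≤ ∑ i, deg (w i).2)) X := by
  rw [BIJ88LeadGroupCompose294.leadGroup_max_eq_neg_pertP (contDiff_genFunMulti Cl deg Wp N) hk hmax]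
  have hdiag : (fun t : ℝ => genFunMulti Cl deg Wp N (t • (Pi.single k (1 : ℝ) : L → ℝ))) =
      genFun Cl (lettersOn deg Wp {k}) deg N := by
    funext t
    rw [← genFunMulti_diag Cl deg Wp N {k} t, Finset.sum_singleton]
  rw [hdiag, pertP_genFun_eq_neg_lowWords Cl sC (lettersOn deg Wp {k}) sW deg hdeg hN, neg_neg]

end MultiScale

/-! ## §8 The common function with p02's (5.7.15): `pertQ5715` on the family `e′ ↦ C⁻¹ − W(e′)` of (5.7.2) -/

section Common

open BIJ88Normalization46 (Z49)

variable {T₀ : Type} [Fintype T₀] [DecidableEq T₀]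
variable (Cl : A → Matrix T₀ T₀ ℝ) (sC : A → Finset ι) (Wl : B → Matrix T₀ T₀ ℝ) (sW : B → Finset ι) (deg : B → ℕ)

omit [Fintype T] [DecidableEq T] [Fintype ι] [DecidableEq ι] [Fintype A] [DecidableEq A] [Fintype B] [DecidableEq B]
  [DecidableEq T₀] in
/-- p02's bracket of (5.7.15), `logZ M e′ = log ∫dφ exp(−½⟨φ, M(e′)φ⟩)`, IS `log` of the typed normalization factor (4.9) `Z49` at
`E = N = 0` — one function for both files. [cite: BalabanImbrieJaffe1988, (4.9) p.275, (5.7.15) p.295] -/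
theorem logZ_eq_log_Z49 (Mf : ℝ → Matrix T₀ T₀ ℝ) (e' : ℝ) :
    BIJ88PertQ5715.logZ Mf e' = Real.log (Z49 (Mf e') 0 0) := by
  simp [BIJ88PertQ5715.logZ, BIJ88PertQ5715.Zloc, Z49]

omit [Fintype T] [DecidableEq T] [DecidableEq A] [DecidableEq B] in
/-- **THE COMMON FUNCTION**: p02's (5.7.15) functional `pertQ5715` (= r16's `pertP ∘ logZ`) EVALUATED ON THE FAMILY
`e′ ↦ C⁻¹ − W^{(j)}(e′)` of (5.7.2) (`W_b(e′) = e′^{deg b}W_b`, orders `≥ 1`) equals MINUS THE SEPARATED LOW-ORDER WORDS of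
`BIJ88Eq5713Localized.prod_Z49_eq5713_order` — under `θ = N_C N_W < 1` and the smallness of (5.7.3)–(5.7.4) for `|e′| < 1`.  This is
*"the terms of order ≤ n̄ … Σ_{n=1}^{n̄}(1/n!)[dⁿ/de′ⁿ log Z(…)]_{e′=0}"* (p. 291) read against *"Q^{(k)} = Σ_{n=1}^{n̄} dⁿ/de′ⁿ log[∫dφ …
]_{e′=0}"* (5.7.15) on one and the same function. [cite: BalabanImbrieJaffe1988, p.291, (5.7.13) p.295, (5.7.15) p.295] -/
theorem pertQ5715_family_eq_neg_lowWords (hdeg : ∀ b, 1 ≤ deg b) (hθ : (∑ a, ‖Cl a‖) * (∑ b, ‖Wl b‖) < 1)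
    {Cinv Sq Sinv : Matrix T₀ T₀ ℝ} (h1 : Sq * Sinv = 1) (h2 : Sinv * Sq = 1) (hC : Sinv * Sinv = Cinv)
    (hSS : Sq * Sq = ∑ a, Cl a) (hCinv : Cinv.PosDef)
    (hT : ∀ t : ℝ, |t| < 1 → (Cinv - ∑ b, scaleW Wl deg t b).PosDef)
    (hW : ∀ t : ℝ, |t| < 1 → ‖Sq * (∑ b, scaleW Wl deg t b) * Sq‖ < 1) (nbar : ℕ) :
    BIJ88PertQ5715.pertQ5715 (fun e' => Cinv - ∑ b, scaleW Wl deg e' b) nbar =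
      -∑ l ∈ Finset.range nbar, ∑ X : Finset ι, 1 / (2 * ((l : ℝ) + 1)) *
        wlen Cl sC Wl sW (l + 1) (fun w => ¬ (nbar + 1 ≤ ∑ i, deg (w i).2)) X := by
  have hfun : BIJ88PertQ5715.logZ (fun e' => Cinv - ∑ b, scaleW Wl deg e' b) =
      fun e' => Real.log (Z49 (Cinv - ∑ b, scaleW Wl deg e' b) 0 0) :=
    funext fun e' => logZ_eq_log_Z49 _ e'
  rw [BIJ88PertQ5715.pertQ5715, hfun]
  exact pertP_logZ49_eq_neg_lowWords Cl sC Wl sW deg hdeg hθ h1 h2 hC hSS hCinv hT hW 0 0 nbar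

variable {L : Type*} [Fintype L] [DecidableEq L] [LinearOrder L]
variable (Wp : (b : B) → (Fin (deg b) → L) → Matrix T₀ T₀ ℝ)

omit [Fintype T] [DecidableEq T] [Fintype ι] [DecidableEq ι] [DecidableEq A] [DecidableEq B] in
/-- **THE `k`-TH GROUP IDENTIFIED WITH `−Q^{(k)}` ON THE COMMON FUNCTION** — for the top scale `k` of `S`: the `k`-th group of
(5.7.10) for the multi-scale generating function equals `−pertQ5715` (p02's (5.7.15) functional) of the family
`e′ ↦ C⁻¹ − W̃_k(e′)` built from the letters seen on the scale `k` alone — *"The term m = k … The result is our standard perturbative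
expansion in the field θ_kH_{k,loc}A^{(k)}, which we denote Q^{(k)}"* (p. 295), under the smallness of (5.7.3)–(5.7.4) along that
family and `θ < 1`. [cite: BalabanImbrieJaffe1988, (5.7.10) p.292, (5.7.13) p.295, (5.7.15) p.295] -/
theorem leadGroup_max_eq_neg_pertQ5715 (hdeg : ∀ b, 1 ≤ deg b) {nbar N : ℕ} (hN : nbar ≤ N) {S : Finset L} {k : L}
    (hk : k ∈ S) (hmax : ∀ l ∈ S, l ≤ k)
    (hθ : (∑ a, ‖Cl a‖) * (∑ b, ‖lettersOn deg Wp {k} b‖) < 1)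
    {Cinv Sq Sinv : Matrix T₀ T₀ ℝ} (h1 : Sq * Sinv = 1) (h2 : Sinv * Sq = 1) (hC : Sinv * Sinv = Cinv)
    (hSS : Sq * Sq = ∑ a, Cl a) (hCinv : Cinv.PosDef)
    (hT : ∀ t : ℝ, |t| < 1 → (Cinv - ∑ b, scaleW (lettersOn deg Wp {k}) deg t b).PosDef)
    (hW : ∀ t : ℝ, |t| < 1 → ‖Sq * (∑ b, scaleW (lettersOn deg Wp {k}) deg t b) * Sq‖ < 1) :
    BIJ88Resummation5710.leadGroup (genFunMulti Cl deg Wp N) nbar S k =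
      -BIJ88PertQ5715.pertQ5715 (fun e' => Cinv - ∑ b, scaleW (lettersOn deg Wp {k}) deg e' b) nbar := by
  -- through the separated words (any cube supports will do: the identity does not involve them)
  rw [leadGroup_max_genFunMulti Cl (fun _ => (∅ : Finset Unit)) (fun _ => (∅ : Finset Unit)) deg Wp hdeg hN hk hmax,
    pertQ5715_family_eq_neg_lowWords Cl (fun _ => (∅ : Finset Unit)) (lettersOn deg Wp {k}) (fun _ => (∅ : Finset Unit)) deg
      hdeg hθ h1 h2 hC hSS hCinv hT hW nbar, neg_neg]

end Common

end Literature.MathematicalPhysics.QuantumFieldTheory.BalabanImbrieJaffe1984to88.BIJ88LowOrderWords291
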